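import Mathlib
import Summits.ValiantsHypothesis.ValiantsHypothesis.Theorems.LacunarySymmetroidMatrixDescartesChainSectorCore

/-!
# `MatrixDescartes` (stmt-ValiantsHypothesis-18050) — the LOEWNER-CHAIN SECTOR: letters increasing in the
# Loewner order along the exponent axis (above a free pivot letter with a negative semidefinite head):
# `Z₊ ≤ m`, K-free

HONEST FRAMING.  Cell `pub-symmetroid`, seat `val-sym-mdr-p2` (gen 4); helper file `--supports` the crux
`Theses.LacunarySymmetroid.MatrixDescartes`.  A SECTOR theorem: it bounds the positive zeros of one structural
class of lacunary symmetric pencils (and records the crux's inequality on the corresponding format family at every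
admissible size).  It decides nothing about the crux in general, nothing about the line `Lift`'s open stub
`stub_twoSided`, nothing about the registers `DoorA26` / `DoorA34`, nothing about `VP ≠ VNP`.

THE RULE (`chainSector`).  Let `F = ∑ₗ X^{dₗ} Sₗ` (`l < K`) be a lacunary pencil of real symmetric `ι × ι` matrices
with the exponents listed increasingly (`d` strictly monotone — for pairwise distinct exponents this is only a
choice of indexing) and let `p < K` be a PIVOT INDEX such that
* every letter below the pivot is negative semidefinite: `Sₗ ⪯ 0` for `l < p` (the HEAD);
* the letters from the pivot on form a LOEWNER CHAIN: `S_p ⪯ S_{p+1} ⪯ ⋯ ⪯ S_{K−1}`, i.e. `Sⱼ − Sᵢ ⪰ 0` for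
  `p ≤ i ≤ j` (the TAIL); the pivot letter `S_p` itself is an ARBITRARY real symmetric matrix, and so may be every
  tail letter — only the DIFFERENCES along the tail are signed.
Then `det F` has at most `card ι` distinct positive zeros, for any number of terms and any exponents.  With `p = 0`
(no head) this is the pure LOEWNER-CHAIN SECTOR `S₀ ⪯ S₁ ⪯ ⋯ ⪯ S_{K−1} ⇒ Z₊ ≤ card ι` (`loewnerChain_posRoots_le`);
by `Sₗ ↦ −Sₗ` one gets the mirror family (positive semidefinite head, DEcreasing chain from the pivot;
`chainSector_mirror`).  At `card ι = 1` the hypothesis says: the coefficients are `≤ 0` up to the pivot and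
non-decreasing after it — at most one sign change — and the bound `1` is Descartes' rule; for matrices the bound
`card ι` is attained by diagonal chains (`X·I − diag(1,…,n)` is a chain with `p = 0`).

POSITION AMONG THE TREE'S K-FREE LAWS.  The one-alternation rule (`oneAlternation`, semidefinite letters of
opposite signs on the two sides of a pivot EXPONENT) and the fan laws of this seat's gens 2–3 (`FanLaw*`,
`VLawCore*`: semidefinite companions inside a kernel window around a pivot and a factoring letter) all sign the
LETTERS; here the tail letters are unconstrained individually (a chain `J, J + P₁, J + P₁ + P₂, …` with `J`
indefinite has every letter indefinite when the `Pᵢ ⪰ 0` are small), so the family is not contained in any of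
those, nor does it contain them.  What the two rules share is the ENGINE (§1): after dividing by a positive weight
the pencil becomes a Loewner non-decreasing family `G(s)`, and kernel vectors at distinct positive zeros of a
Loewner-monotone family are linearly independent (tree `stub_inertiaChain`).  For the one-alternation rule the
weight is the pivot monomial `x^e`; here it is the TAIL SUM `φ_p(x) = ∑_{l ≥ p} x^{dₗ}`, and monotonicity of
`F/φ_p` is a Chebyshev-sum-inequality phenomenon: for `0 < s ≤ t`,
`φ_p(s)·vᵀF(t)v − φ_p(t)·vᵀF(s)v = ∑_{l<p≤l'} w_{ll'} q_l + ½ ∑_{l,l' ≥ p} w_{ll'} (q_l − q_{l'})` with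
`q_l = vᵀSₗv`, `w_{ll'} = s^{d_{l'}} t^{d_l} − t^{d_{l'}} s^{d_l}` (`≥ 0` iff `d_{l'} ≤ d_l`), and every summand is
`≥ 0` under the head/tail hypotheses (`ChainSector.key_nonneg`); if the whole expression vanishes for some `s < t`
then `q_l = 0` on the head and `q` is constant on the tail (`ChainSector.key_eq_zero`), which for a kernel vector
forces `F(x)v = φ_p(x)·S_p v ≡ 0`, i.e. `det F = 0` (`ChainSector.kernelData`).

IN THE CRUX'S CURRENCY (`chainWord_realRoots_le`, `chainSector_mdr`).  If both `F(X)` and the reflected pencil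
`F(−X) = ∑ₗ X^{dₗ} ((−1)^{dₗ} Sₗ)` are chain words (e.g. all exponents even), `det F` has at most `2·card ι + 1`
distinct real zeros (tree `stub_negRoots`), and in the regime `m ≤ 2^((⌊log₂K⌋+c)^c)` this gives
`Z^q ≤ 2^(K⌊log₂K⌋)` for all large `K` (tree `linearCount_absorbed`): a format family — beyond the census table and
beyond the letter-signed sectors — on which the inequality of `MatrixDescartes` is a theorem at every admissible
size, fat formats included.  Nothing is claimed outside the family.

presearch: «Loewner-ordered / monotone coefficients of a self-adjoint matrix polynomial ⇒ few real eigenvalues» →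
none (corpus hybrid + vsearch: Horn–Johnson, Basu–Pollack–Roy, Kaashoek–Rodman–Woerdeman only generic hits; zbMATH 0;
galaxy 0 relevant); nearest in print is the definite-coefficient rule of [CameronPsarrakos2019, Lemma 6]
(`α ∈ {0,1,m}`), which signs letters, not differences.  Elementary; Mathlib + tree lemmas (`stub_inertiaChain`,
`stub_negRoots`, `linearCount_absorbed`, `OneAlternation.dotProduct_family_mulVec`); axioms `propext`,
`Classical.choice`, `Quot.sound`.
-/

-- layout Summits/ValiantsHypothesis/ValiantsHypothesis forces the duplicated namespace component
set_option linter.dupNamespace false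

namespace Summit.ValiantsHypothesis.ValiantsHypothesis.Theorems.LacunarySymmetroidMatrixDescartes

open Polynomial Matrix Finset
open scoped BigOperators

/-! ## §3 The sector theorems -/

/-- **LOEWNER-CHAIN SECTOR (with a negative semidefinite head), K-free.**  Let `Sₗ` (`l < K`) be real symmetric
`ι × ι` matrices at strictly increasing exponents `dₗ`, and let `p` be a pivot index such that `Sₗ ⪯ 0` for
`l < p` and `Sᵢ ⪯ Sⱼ` whenever `p ≤ i ≤ j` (the pivot letter `S_p` and the individual tail letters are
arbitrary; only the differences along the tail are signed).  Then `det (∑ₗ X^{dₗ} Sₗ)` has at most `card ι` distinct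
positive zeros, for any number of terms.  Tight (diagonal chains); at `card ι = 1` it is Descartes' rule for one
sign change.  Not contained in, and not containing, the letter-signed K-free laws of the tree (`oneAlternation`,
`FanLaw*`). [folklore] -/
theorem chainSector (ι : Type) [Fintype ι] [DecidableEq ι] (K : ℕ) (d : Fin K → ℕ) (hd : StrictMono d)
    (S : Fin K → Matrix ι ι ℝ) (hS : ∀ l, (S l).IsSymm) (p : Fin K)
    (hhead : ∀ l, l < p → (-S l).PosSemidef) (htail : ∀ i j, p ≤ i → i ≤ j → (S j - S i).PosSemidef) :
    ((Matrix.det (∑ l, ((Polynomial.X : Polynomial ℝ) ^ d l) • (S l).map Polynomial.C)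
        ).roots.toFinset.filter (fun t => 0 < t)).card ≤ Fintype.card ι := by
  set P := Matrix.det (∑ l, ((Polynomial.X : Polynomial ℝ) ^ d l) • (S l).map Polynomial.C)
    with hPdef
  by_cases hdet : P = 0
  · simp [hdet]
  -- enumerate the positive roots increasingly
  set R := P.roots.toFinset.filter (fun t => 0 < t) with hR
  let τ : Fin R.card ↪o ℝ := R.orderEmbOfFin rfl
  have hτmem : ∀ j, τ j ∈ R := fun j => R.orderEmbOfFin_mem rfl j
  have hτpos : ∀ j, 0 < τ j := fun j => (Finset.mem_filter.1 (hτmem j)).2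
  have hτroot : ∀ j, P.IsRoot (τ j) := fun j => by
    have h1 := (Finset.mem_filter.1 (hτmem j)).1
    rw [Multiset.mem_toFinset] at h1
    exact (Polynomial.mem_roots hdet).1 h1
  -- the normalised family and its kernel data at each root
  let G : ℝ → Matrix ι ι ℝ := fun u =>
    ((∑ l' ∈ univ.filter (fun l' => p ≤ l'), u ^ d l')⁻¹ • ∑ l, (u ^ d l) • S l)
  have hdata : ∀ j, ∃ v : ι → ℝ, v ≠ 0 ∧ G (τ j) *ᵥ v = 0 ∧
      ∀ s : ℝ, τ j < s → 0 < v ⬝ᵥ (G s *ᵥ v) :=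
    fun j => ChainSector.kernelData d hd S p hhead htail hdet (τ j) (hτpos j) (hτroot j)
  choose v _hv0 hker hpos using hdata
  exact stub_inertiaChain ι G (fun u => ChainSector.family_isSymm d S hS p u)
    (fun s t hs hst => ChainSector.family_mono d hd S hS p hhead htail s t hs hst) R.card τ
    τ.strictMono hτpos v hker hpos

/-- **The pure Loewner-chain sector** (`p = 0`, no head): real symmetric letters at strictly increasing exponents
with `S₀ ⪯ S₁ ⪯ ⋯ ⪯ S_{K−1}` — every letter may be indefinite — give at most `card ι` distinct positive zeros of
`det (∑ₗ X^{dₗ} Sₗ)`, for every `K`. [folklore] -/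
theorem loewnerChain_posRoots_le (ι : Type) [Fintype ι] [DecidableEq ι] (K : ℕ) (d : Fin K → ℕ)
    (hd : StrictMono d) (S : Fin K → Matrix ι ι ℝ) (hS : ∀ l, (S l).IsSymm)
    (hchain : ∀ i j, i ≤ j → (S j - S i).PosSemidef) :
    ((Matrix.det (∑ l, ((Polynomial.X : Polynomial ℝ) ^ d l) • (S l).map Polynomial.C)
        ).roots.toFinset.filter (fun t => 0 < t)).card ≤ Fintype.card ι := by
  rcases Nat.eq_zero_or_pos K with hK | hK
  · -- no letters: the pencil is `0`, whose determinant is a constant (`0` or `1`): no roots at all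
    subst hK
    have h0 : (∑ l : Fin 0, ((Polynomial.X : Polynomial ℝ) ^ d l) • (S l).map Polynomial.C) = 0 :=
      Finset.sum_of_isEmpty _
    rw [h0]
    rcases isEmpty_or_nonempty ι with hι | hι
    · rw [Matrix.det_isEmpty, Polynomial.roots_one]
      simp
    · rw [Matrix.det_zero, Polynomial.roots_zero]
      simp
  · exact chainSector ι K d hd S hS ⟨0, hK⟩
      (fun l hl => absurd (Fin.lt_def.1 hl) (Nat.not_lt_zero _)) (fun i j _ hij => hchain i j hij)

/-- **Mirror form**: positive semidefinite head `Sₗ ⪰ 0` (`l < p`), arbitrary pivot letter, DEcreasing chain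
`S_p ⪰ S_{p+1} ⪰ ⋯` above it — at most `card ι` distinct positive zeros (apply `chainSector` to `−F`). [folklore] -/
theorem chainSector_mirror (ι : Type) [Fintype ι] [DecidableEq ι] (K : ℕ) (d : Fin K → ℕ) (hd : StrictMono d)
    (S : Fin K → Matrix ι ι ℝ) (hS : ∀ l, (S l).IsSymm) (p : Fin K)
    (hhead : ∀ l, l < p → (S l).PosSemidef) (htail : ∀ i j, p ≤ i → i ≤ j → (S i - S j).PosSemidef) :
    ((Matrix.det (∑ l, ((Polynomial.X : Polynomial ℝ) ^ d l) • (S l).map Polynomial.C)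
        ).roots.toFinset.filter (fun t => 0 < t)).card ≤ Fintype.card ι := by
  rw [← roots_det_pencil_neg d S]
  refine chainSector ι K d hd (fun l => -S l) (fun l => (hS l).neg) p
    (fun l hl => by rw [neg_neg]; exact hhead l hl) (fun i j hpi hij => ?_)
  have e : -S j - -S i = S i - S j := by abel
  rw [e]
  exact htail i j hpi hij

/-- **Real zeros of a two-way chain word.**  If `F = ∑ₗ X^{dₗ} Sₗ` (real symmetric `m × m` letters at strictly
increasing exponents, `K` terms) is a chain word for a pivot index `p` (`Sₗ ⪯ 0` below, Loewner chain from `p`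
on) and the reflected pencil `F(−X) = ∑ₗ X^{dₗ} ((−1)^{dₗ} Sₗ)` is one for a pivot index `p'`, then `det F` has at
most `2m + 1` distinct real zeros (positive zeros of `F`, of `F(−X)`, and the origin; tree `stub_negRoots`).
[folklore] -/
theorem chainWord_realRoots_le (K m : ℕ) (d : Fin K → ℕ) (hd : StrictMono d)
    (S : Fin K → Matrix (Fin m) (Fin m) ℝ) (hS : ∀ l, (S l).IsSymm) (p p' : Fin K)
    (hhead : ∀ l, l < p → (-S l).PosSemidef) (htail : ∀ i j, p ≤ i → i ≤ j → (S j - S i).PosSemidef)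
    (hhead' : ∀ l, l < p' → (-(((-1 : ℝ) ^ d l) • S l)).PosSemidef)
    (htail' : ∀ i j, p' ≤ i → i ≤ j → (((-1 : ℝ) ^ d j) • S j - ((-1 : ℝ) ^ d i) • S i).PosSemidef) :
    (Matrix.det (∑ l, ((Polynomial.X : Polynomial ℝ) ^ d l) • (S l).map Polynomial.C)
      ).roots.toFinset.card ≤ 2 * m + 1 := by
  have h1 := chainSector (Fin m) K d hd S hS p hhead htail
  have h2 := chainSector (Fin m) K d hd (fun l => ((-1 : ℝ) ^ d l) • S l) (fun l => (hS l).smul _) p'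
    hhead' htail'
  have h3 := stub_negRoots K m d S
  rw [Fintype.card_fin] at h1 h2
  omega

/-- **The crux's inequality on two-way chain words (the Loewner-chain format family), at every admissible size.**
For all `c, q` there is `K₀` such that for all `K ≥ K₀`, all sizes `m ≤ 2^((⌊log₂K⌋+c)^c)`, all strictly increasing
exponents `d` and all real symmetric `Sₗ` for which `F(X)` and `F(−X)` are chain words (pivot indices `p, p'`;
negative semidefinite heads, Loewner chains from the pivot on), the number `Z` of distinct real zeros of
`det (∑ₗ X^{dₗ} Sₗ)` satisfies `Z^q ≤ 2^(K⌊log₂K⌋)` — the statement of `MatrixDescartes` restricted to this format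
family, fat formats included.  Nothing is claimed outside the family. [folklore] -/
theorem chainSector_mdr (c q : ℕ) : ∃ K₀ : ℕ, ∀ K m : ℕ, K₀ ≤ K →
    m ≤ 2 ^ ((Nat.log 2 K + c) ^ c) → ∀ (d : Fin K → ℕ), StrictMono d →
      ∀ (S : Fin K → Matrix (Fin m) (Fin m) ℝ), (∀ l, (S l).IsSymm) → ∀ p p' : Fin K,
      (∀ l, l < p → (-S l).PosSemidef) → (∀ i j, p ≤ i → i ≤ j → (S j - S i).PosSemidef) →
      (∀ l, l < p' → (-(((-1 : ℝ) ^ d l) • S l)).PosSemidef) →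
      (∀ i j, p' ≤ i → i ≤ j → (((-1 : ℝ) ^ d j) • S j - ((-1 : ℝ) ^ d i) • S i).PosSemidef) →
      (Matrix.det (∑ l, ((Polynomial.X : Polynomial ℝ) ^ d l) • (S l).map Polynomial.C)
        ).roots.toFinset.card ^ q ≤ 2 ^ (K * Nat.log 2 K) := by
  obtain ⟨K₁, hK₁⟩ := linearCount_absorbed c q
  exact ⟨K₁, fun K m hK hm d hd S hS p p' hhead htail hhead' htail' =>
    hK₁ K m _ hK hm (chainWord_realRoots_le K m d hd S hS p p' hhead htail hhead' htail')⟩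

end Summit.ValiantsHypothesis.ValiantsHypothesis.Theorems.LacunarySymmetroidMatrixDescartes
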